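import Mathlib
import HarnessLib
import Summits.HubbardSuperconductivity.HubbardSuperconductivity.Theorems.KLProgrammeKLRegimeWickCrossContractionGramFamily
import Summits.HubbardSuperconductivity.HubbardSuperconductivity.Theorems.KLProgrammeKLRegimeWickCrossContractionGramTail

/-!
# Route `KLProgramme` — ENGINE child gen 8 (stmt-HubbardSuperconductivity-20437 `KLRegimeEngineV17F2`), stub (c) `stub_engine_step_values`,
# (E2-v10)/E.5 lane: the ASSEMBLED line-number tail of the two-vertex term, VALUE form, engine currency
# (cell gate-hubbard-kl, seat p5 g6; composes `…GramFamily` (p526297) with `…GramTail` (p531120))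

The source of the within-slice flow (`klws_flow_source_eq`, continuous organisation of record KLTC-INDEX-v5 §B) and the `j`-line terms of the
discrete Wick step (`klw_wickPairAmplitude_succ_lines`) contain, for every line number `k`, a two-vertex cross contraction with ONE
distinguished line (the slice line `Ċ_Λ` / `g_{n+1}`, symbol `s₀`: small `L¹` size `α`) and `k − 1` lines of a second symbol `s₁` (the soft /
Wick-ordering covariance `D_Λ`: entries `≤ δ`, Gram constant `κ_{s₁}`), weighted by `(k!)⁻¹` (discrete) or `((k−1)!)⁻¹` (continuous:
`Δ_×(Ċ)∘(l!)⁻¹Δ_×(D)^l`, `l = k − 1`).  `…GramFamily` bounds each term with `e' + 1` explicit lines and a Gram tail whose base `Σ_{s∈ι}κ_s²`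
does not depend on `k`; `…GramTail` sums the resulting coefficients in closed form.  Here the two are composed:

* §1 `listProd_ite_zero_eq_pow_mul` — the two-symbol line family `i ↦ if i = 0 then g else D` on `Fin (l+1)` has product `Δ_×(D)^l·Δ_×(g)`
  (how a consumer matches its `l`-th term to the `k = l + 1` summand below), `apply_ite_zero` (under any map, e.g. the pull-back `SᵀCS`);
* §2 **`sum_norm_kernel_crossContract_value_sectorPreimage_le_gramTail`** (+ `_of_b`, roles exchanged) — weight `(k!)⁻¹`:
  `Σ_{k=e'+1}^{N} (k!)⁻¹‖kernel(Π_k(Ga⁰Gb¹)) m (Z,s)‖ ≤ ((m₀+1+m₁+e'+1)!/(m!(1−x)^{m₀+m₁+e'+3}))·α·(δ·4ρ₀)^{e'}·A`, given the line data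
  (`α` row/column sums of the pulled-back `s₀` line, `δ` entries of the pulled-back `s₁` lines, `κ` Gram constants), per-`k` level norms
  `Na k`, `Nb k` of the vertices exactly as in `…_sectorPreimage_le_gramF`, and ONE envelope hypothesis
  `(Σ_tκ_t²)^{k−e'−1}·(εNa k)(εNb k) ≤ x^{k−e'−1}·A` (`0 ≤ x < 1`) carrying the consumer's power counting (vertex-degree growth per extra line
  against the Gram base);
* §3 **`…_gramTail_mul`** (+ `_of_b`) — weight `((k−1)!)⁻¹`: `≤ ((m₀+m₁+e'+3)!/(m!(1−x)^{m₀+m₁+e'+4}))·α·(δ·4ρ₀)^{e'}·A`.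

`N`-uniform (the model's `N = |HubbardFieldIdx × Fin 2| + 1` never enters the bound).  Bookkeeping over landed theorems; no definitions, no named
facts, nothing about the model's sizes is asserted.
-/

noncomputable section

namespace Summit.HubbardSuperconductivity.HubbardSuperconductivity.Theorems.KLRegimeWick

set_option linter.dupNamespace false -- summit = problem name (single-conjunct summit), D-0017

open Literature.MathematicalPhysics.QuantumLattice Literature.Probability.LatticeModels GrassmannAlgebra Finset Matrix Nat
open Summit.HubbardSuperconductivity.HubbardSuperconductivity.Theorems.KLRegimeSplit

/-! ## §1 The two-symbol line family -/

section Operators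

variable (R : Type*) [CommRing R] [Algebra ℚ R] {Γ : Type*} [Fintype Γ]

/-- **The two-symbol line family of one term**: the lines `i ↦ if i = 0 then g else D` on `Fin (l + 1)` (format of
`crossLaplacian_listProd_copy_mul_copy` / `…_le_gramF`, line `0` = the distinguished line) have product `Δ_×(D)^l · Δ_×(g)`. [folklore] -/
theorem listProd_ite_zero_eq_pow_mul (g D : Matrix Γ Γ R) (l : ℕ) :
    ((List.ofFn fun i : Fin (l + 1) => grassmannLaplacian R (crossCov R (if (i : ℕ) = 0 then g else D))).reverse).prod =
      grassmannLaplacian R (crossCov R D) ^ l * grassmannLaplacian R (crossCov R g) := by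
  rw [List.ofFn_succ]
  simp only [Fin.val_zero, if_true, Fin.val_succ, Nat.succ_ne_zero, if_false]
  rw [List.ofFn_const, List.reverse_cons, List.reverse_replicate, List.prod_append, List.prod_replicate, List.prod_singleton]

omit [Algebra ℚ R] [Fintype Γ] in
/-- Any map commutes with the two-symbol line family (e.g. the pull-back `C ↦ S(F)ᵀ·C·S(F)`). [folklore] -/
theorem apply_ite_zero {α β : Type*} (f : α → β) (g D : α) {k : ℕ} (i : Fin k) :
    f (if (i : ℕ) = 0 then g else D) = if (i : ℕ) = 0 then f g else f D := apply_ite f _ g D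

end Operators

/-! ## §2 The real core: per-`k` bounds of the bridge's shape + the envelope ⟹ the closed form -/

section Core

/-- Core, weight `(k!)⁻¹`. -/
private theorem tail_core {e m a b Nmax : ℕ} (B : ℕ → ℝ) (hB0 : ∀ k, 0 ≤ B k) {X P : ℝ} (hP : 0 ≤ P) (Na Nb : ℕ → ℝ)
    {x A : ℝ} (hx0 : 0 ≤ x) (hx1 : x < 1) (hA : 0 ≤ A)
    (hB : ∀ k ∈ Icc e Nmax, B k ≤ ((k + a)! * (k + b)! : ℝ) / (m ! * (k - e)!) * X ^ (k - e) * (P * Na k * Nb k))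
    (henv : ∀ k ∈ Icc e Nmax, X ^ (k - e) * (Na k * Nb k) ≤ x ^ (k - e) * A) :
    ∑ k ∈ Icc e Nmax, (k ! : ℝ)⁻¹ * B k ≤ ((a + b + e)! : ℝ) / (m ! * (1 - x) ^ (a + b + e + 1)) * (P * A) := by
  have h := klgt_norm_sum_le_of_tail (E := ℝ) (fun k => (k ! : ℝ)⁻¹ * B k) hx0 hx1 (mul_nonneg hP hA) a b e m Nmax fun k hk => ?_
  · refine le_trans (le_of_eq ?_) h
    rw [Real.norm_of_nonneg (sum_nonneg fun k _ => mul_nonneg (inv_nonneg.2 (by positivity)) (hB0 k))]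
  · rw [Real.norm_of_nonneg (mul_nonneg (inv_nonneg.2 (by positivity)) (hB0 k))]
    have hk0 : (0 : ℝ) < k ! := by positivity
    have hK : (0 : ℝ) ≤ ((k + a)! * (k + b)! : ℝ) / (k ! * m ! * (k - e)!) * P := by positivity
    calc (k ! : ℝ)⁻¹ * B k ≤ (k ! : ℝ)⁻¹ * (((k + a)! * (k + b)! : ℝ) / (m ! * (k - e)!) * X ^ (k - e) * (P * Na k * Nb k)) :=
          mul_le_mul_of_nonneg_left (hB k hk) (inv_nonneg.2 hk0.le)
      _ = ((k + a)! * (k + b)! : ℝ) / (k ! * m ! * (k - e)!) * P * (X ^ (k - e) * (Na k * Nb k)) := by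
          rw [div_eq_mul_inv, div_eq_mul_inv, mul_inv, mul_inv, mul_inv]
          ring
      _ ≤ ((k + a)! * (k + b)! : ℝ) / (k ! * m ! * (k - e)!) * P * (x ^ (k - e) * A) := mul_le_mul_of_nonneg_left (henv k hk) hK
      _ = ((k + a)! * (k + b)! : ℝ) / (k ! * m ! * (k - e)!) * x ^ (k - e) * (P * A) := by ring

/-- Core, weight `((k−1)!)⁻¹` (`1 ≤ e`). -/
private theorem tail_core_mul {e m a b Nmax : ℕ} (he : 1 ≤ e) (B : ℕ → ℝ) (hB0 : ∀ k, 0 ≤ B k) {X P : ℝ} (hP : 0 ≤ P) (Na Nb : ℕ → ℝ)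
    {x A : ℝ} (hx0 : 0 ≤ x) (hx1 : x < 1) (hA : 0 ≤ A)
    (hB : ∀ k ∈ Icc e Nmax, B k ≤ ((k + a)! * (k + b)! : ℝ) / (m ! * (k - e)!) * X ^ (k - e) * (P * Na k * Nb k))
    (henv : ∀ k ∈ Icc e Nmax, X ^ (k - e) * (Na k * Nb k) ≤ x ^ (k - e) * A) :
    ∑ k ∈ Icc e Nmax, ((k - 1)! : ℝ)⁻¹ * B k ≤ ((a + b + e + 1)! : ℝ) / (m ! * (1 - x) ^ (a + b + e + 2)) * (P * A) := by
  have h := klgt_norm_sum_le_of_tail_mul (E := ℝ) (fun k => ((k - 1)! : ℝ)⁻¹ * B k) hx0 hx1 (mul_nonneg hP hA) a b e m Nmax fun k hk => ?_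
  · refine le_trans (le_of_eq ?_) h
    rw [Real.norm_of_nonneg (sum_nonneg fun k _ => mul_nonneg (inv_nonneg.2 (by positivity)) (hB0 k))]
  · rw [Real.norm_of_nonneg (mul_nonneg (inv_nonneg.2 (by positivity)) (hB0 k))]
    have hk1 : 1 ≤ k := he.trans (mem_Icc.1 hk).1
    have hk0 : (0 : ℝ) < (k - 1)! := by positivity
    have hK : (0 : ℝ) ≤ (k : ℝ) * (((k + a)! * (k + b)! : ℝ) / (k ! * m ! * (k - e)!)) * P := by positivity
    calc ((k - 1)! : ℝ)⁻¹ * B k ≤ ((k - 1)! : ℝ)⁻¹ * (((k + a)! * (k + b)! : ℝ) / (m ! * (k - e)!) * X ^ (k - e) * (P * Na k * Nb k)) :=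
          mul_le_mul_of_nonneg_left (hB k hk) (inv_nonneg.2 hk0.le)
      _ = ((k + a)! * (k + b)! : ℝ) / ((k - 1)! * m ! * (k - e)!) * P * (X ^ (k - e) * (Na k * Nb k)) := by
          rw [div_eq_mul_inv, div_eq_mul_inv, mul_inv, mul_inv, mul_inv]
          ring
      _ = (k : ℝ) * (((k + a)! * (k + b)! : ℝ) / (k ! * m ! * (k - e)!)) * P * (X ^ (k - e) * (Na k * Nb k)) := by
          rw [klgt_coeff_pred_factorial_eq hk1]
      _ ≤ (k : ℝ) * (((k + a)! * (k + b)! : ℝ) / (k ! * m ! * (k - e)!)) * P * (x ^ (k - e) * A) := mul_le_mul_of_nonneg_left (henv k hk) hK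
      _ = (k : ℝ) * (((k + a)! * (k + b)! : ℝ) / (k ! * m ! * (k - e)!)) * x ^ (k - e) * (P * A) := by ring

end Core

/-! ## §3 The assembled tail in engine currency (lines via `Ft`, vertices the `F`-sector preimages) -/

section Assignment

variable {ι : Type*}

/-- The two-symbol assignment reads `s₀` on line `0`. -/
private theorem ite_castLE_zero {k e' : ℕ} (he : e' + 1 ≤ k) (s₀ s₁ : ι) :
    (if ((Fin.castLE he 0 : Fin k) : ℕ) = 0 then s₀ else s₁) = s₀ := by
  rw [Fin.val_castLE, Fin.val_zero, if_pos rfl]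

/-- The two-symbol assignment reads `s₁` on the lines `i.succ`. -/
private theorem ite_castLE_succ {k e' : ℕ} (he : e' + 1 ≤ k) (s₀ s₁ : ι) (i : Fin e') :
    (if ((Fin.castLE he i.succ : Fin k) : ℕ) = 0 then s₀ else s₁) = s₁ := by
  rw [Fin.val_castLE, Fin.val_succ, if_neg (Nat.succ_ne_zero _)]

end Assignment

section Engine

variable {L M N : ℕ} [NeZero L] {ι : Type*} [Fintype ι] [DecidableEq ι]

/-- **The assembled line-number tail, VALUE form, weight `(k!)⁻¹`** (`m₀ + 1 ≥ 1` output legs from `a`; `Ga` at `F`-level `m₀ + 1`, `Gb` at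
`F`-level `e' + 1 + m₁`, both read per `k` as in `norm_kernel_crossContract_value_sectorPreimage_le_gramF`; line `0` of symbol `s₀` with
row/column sums `≤ α`, lines `≥ 1` of symbol `s₁` with entries `≤ δ`, `e'` of them explicit; Gram constants `κ`; ONE envelope hypothesis
`(Σ_tκ_t²)^{k−e'−1}·(εNa k)(εNb k) ≤ x^{k−e'−1}·A`):
`Σ_{k=e'+1}^{Nmax} (k!)⁻¹‖kernel(Π_k(a⁰b¹)) m (Z,s)‖ ≤ ((m₀+1+m₁+(e'+1))!/(m!(1−x)^{m₀+1+m₁+(e'+1)+1}))·(α·(δ·4ρ₀)^{e'}·A)`.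
[cite: BenfattoGiulianiMastropietro2006, §2.8 (2.80)] -/
theorem sum_norm_kernel_crossContract_value_sectorPreimage_le_gramTail {e' m m₀ m₁ Nmax : ℕ} {β : ℝ} (hβ : 0 ≤ β)
    (F Ft : Fin N → FreqMomentum L M → ℂ)
    {ρ₀ : ℕ} (hρ₀ : ∀ ω : Fin N, ((univ : Finset (Fin N)).filter fun ω' => ∃ q, Ft ω q * Ft ω' q ≠ 0).card ≤ ρ₀)
    (sym : ι → FreqMomentum L M × Fin 2 → ℂ) (s₀ s₁ : ι) (κ : ι → ℝ)
    (hκF : ∀ (t : ι) (Y : SpaceTimeIdx L M × SectorLeg N), Y.2.2 = 0 → ‖sectorGramF L M β Ft (sym t) Y‖ ≤ κ t)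
    (hκG : ∀ (t : ι) (Y : SpaceTimeIdx L M × SectorLeg N), Y.2.2 = 1 → ‖sectorGramG L M β Ft (sym t) Y‖ ≤ κ t)
    (Ga Gb : HubbardGrassmann L M) (s : Fin m → Fin 2)
    (hm₀ : (univ.filter fun i => s i = 0).card = m₀ + 1) (hm₁ : (univ.filter fun i => s i = 1).card = m₁)
    (Z : Fin m → SpaceTimeIdx L M × SectorLeg N) {α : ℝ} (hα : 0 ≤ α)
    (hrow : ∀ X, ∑ Y, ‖((sectorSubMatrix L M β Ft).transpose * normalCovariance L M (sym s₀) * sectorSubMatrix L M β Ft) X Y‖ ≤ α)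
    (hcol : ∀ Y, ∑ X, ‖((sectorSubMatrix L M β Ft).transpose * normalCovariance L M (sym s₀) * sectorSubMatrix L M β Ft) X Y‖ ≤ α)
    {δ : ℝ} (hδ : 0 ≤ δ) (hent : ∀ X Y, ‖((sectorSubMatrix L M β Ft).transpose * normalCovariance L M (sym s₁) * sectorSubMatrix L M β Ft) X Y‖ ≤ δ)
    (Na Nb : ℕ → ℝ) (hNb0 : ∀ k, 0 ≤ Nb k)
    (hNa : ∀ k ∈ Icc (e' + 1) Nmax, ∀ σ₀ : Fin (m₀ + 1) → SectorLeg N, hubbardSectorKernelNorm L M β F (prescribedTuples univ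
      (Fin.append (fun _ : Fin k => (none : Option (SectorLeg N))) (fun j => some (σ₀ j)))) Ga ≤ Na k)
    (hNb : ∀ k ∈ Icc (e' + 1) Nmax, ∀ (ω₀ : SectorLeg N) (τ' : Fin e' → SectorLeg N) (ω₁ : Fin m₁ → SectorLeg N),
      hubbardSectorKernelNorm L M β F (prescribedTuples univ
        (Fin.append (fun i : Fin k => if h : (i : ℕ) < e' + 1 then some ((Fin.cons ω₀ τ' : Fin (e' + 1) → SectorLeg N) ⟨i, h⟩) else none)
          (fun j => some (ω₁ j)))) Gb ≤ Nb k)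
    {x A : ℝ} (hx0 : 0 ≤ x) (hx1 : x < 1) (hA : 0 ≤ A)
    (henv : ∀ k ∈ Icc (e' + 1) Nmax,
      (∑ t, κ t ^ 2) ^ (k - (e' + 1)) * ((imagTimeWeight β M * Na k) * (imagTimeWeight β M * Nb k)) ≤ x ^ (k - (e' + 1)) * A) :
    ∑ k ∈ Icc (e' + 1) Nmax, (k ! : ℝ)⁻¹ *
      ‖kernel ℂ (((List.ofFn fun i : Fin k => grassmannLaplacian ℂ (crossCov ℂ
        ((sectorSubMatrix L M β Ft).transpose * normalCovariance L M (sym (if (i : ℕ) = 0 then s₀ else s₁)) * sectorSubMatrix L M β Ft))).reverse).prod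
        (dblCopy ℂ 0 (sectorPreimage β F Ga) * dblCopy ℂ 1 (sectorPreimage β F Gb))) m (fun i => (Z i, s i))‖ ≤
      (((m₀ + 1) + m₁ + (e' + 1))! : ℝ) / (m ! * (1 - x) ^ ((m₀ + 1) + m₁ + (e' + 1) + 1)) * (α * (δ * ((4 * ρ₀ : ℕ) : ℝ)) ^ e' * A) := by
  refine tail_core _ (fun k => norm_nonneg _) (by positivity : (0 : ℝ) ≤ α * (δ * ((4 * ρ₀ : ℕ) : ℝ)) ^ e')
    (fun k => imagTimeWeight β M * Na k) (fun k => imagTimeWeight β M * Nb k) hx0 hx1 hA (fun k hk => ?_) henv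
  have he : e' + 1 ≤ k := (mem_Icc.1 hk).1
  have h := norm_kernel_crossContract_value_sectorPreimage_le_gramF (ι := ι) he hβ F Ft hρ₀ sym (fun i : Fin k => if (i : ℕ) = 0 then s₀ else s₁)
    κ hκF hκG Ga Gb s hm₀ hm₁ Z hα (by rw [ite_castLE_zero he]; exact hrow) (by rw [ite_castLE_zero he]; exact hcol) (fun _ : Fin e' => δ)
    (fun _ => hδ) (fun i X Y => by rw [ite_castLE_succ he]; exact hent X Y) (hNb0 k) (hNa k hk) (hNb k hk)
  rw [prod_const, Finset.card_univ, Fintype.card_fin] at h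
  refine h.trans (le_of_eq ?_)
  ring

/-- **The assembled line-number tail, VALUE form, weight `(k!)⁻¹`, roles exchanged** (every output leg may come from `b`: `m₁ + 1` legs from `b`;
`Ga` at `F`-level `e' + 1 + m₀`, `Gb` at `F`-level `m₁ + 1`). [cite: BenfattoGiulianiMastropietro2006, §2.8 (2.80)] -/
theorem sum_norm_kernel_crossContract_value_sectorPreimage_le_gramTail_of_b {e' m m₀ m₁ Nmax : ℕ} {β : ℝ} (hβ : 0 ≤ β)
    (F Ft : Fin N → FreqMomentum L M → ℂ)
    {ρ₀ : ℕ} (hρ₀ : ∀ ω : Fin N, ((univ : Finset (Fin N)).filter fun ω' => ∃ q, Ft ω q * Ft ω' q ≠ 0).card ≤ ρ₀)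
    (sym : ι → FreqMomentum L M × Fin 2 → ℂ) (s₀ s₁ : ι) (κ : ι → ℝ)
    (hκF : ∀ (t : ι) (Y : SpaceTimeIdx L M × SectorLeg N), Y.2.2 = 0 → ‖sectorGramF L M β Ft (sym t) Y‖ ≤ κ t)
    (hκG : ∀ (t : ι) (Y : SpaceTimeIdx L M × SectorLeg N), Y.2.2 = 1 → ‖sectorGramG L M β Ft (sym t) Y‖ ≤ κ t)
    (Ga Gb : HubbardGrassmann L M) (s : Fin m → Fin 2)
    (hm₀ : (univ.filter fun i => s i = 0).card = m₀) (hm₁ : (univ.filter fun i => s i = 1).card = m₁ + 1)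
    (Z : Fin m → SpaceTimeIdx L M × SectorLeg N) {α : ℝ} (hα : 0 ≤ α)
    (hrow : ∀ X, ∑ Y, ‖((sectorSubMatrix L M β Ft).transpose * normalCovariance L M (sym s₀) * sectorSubMatrix L M β Ft) X Y‖ ≤ α)
    (hcol : ∀ Y, ∑ X, ‖((sectorSubMatrix L M β Ft).transpose * normalCovariance L M (sym s₀) * sectorSubMatrix L M β Ft) X Y‖ ≤ α)
    {δ : ℝ} (hδ : 0 ≤ δ) (hent : ∀ X Y, ‖((sectorSubMatrix L M β Ft).transpose * normalCovariance L M (sym s₁) * sectorSubMatrix L M β Ft) X Y‖ ≤ δ)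
    (Na Nb : ℕ → ℝ) (hNa0 : ∀ k, 0 ≤ Na k)
    (hNa : ∀ k ∈ Icc (e' + 1) Nmax, ∀ (ω₀ : SectorLeg N) (σ' : Fin e' → SectorLeg N) (ω₁ : Fin m₀ → SectorLeg N),
      hubbardSectorKernelNorm L M β F (prescribedTuples univ
        (Fin.append (fun i : Fin k => if h : (i : ℕ) < e' + 1 then some ((Fin.cons ω₀ σ' : Fin (e' + 1) → SectorLeg N) ⟨i, h⟩) else none)
          (fun j => some (ω₁ j)))) Ga ≤ Na k)
    (hNb : ∀ k ∈ Icc (e' + 1) Nmax, ∀ σ₁ : Fin (m₁ + 1) → SectorLeg N, hubbardSectorKernelNorm L M β F (prescribedTuples univ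
      (Fin.append (fun _ : Fin k => (none : Option (SectorLeg N))) (fun j => some (σ₁ j)))) Gb ≤ Nb k)
    {x A : ℝ} (hx0 : 0 ≤ x) (hx1 : x < 1) (hA : 0 ≤ A)
    (henv : ∀ k ∈ Icc (e' + 1) Nmax,
      (∑ t, κ t ^ 2) ^ (k - (e' + 1)) * ((imagTimeWeight β M * Na k) * (imagTimeWeight β M * Nb k)) ≤ x ^ (k - (e' + 1)) * A) :
    ∑ k ∈ Icc (e' + 1) Nmax, (k ! : ℝ)⁻¹ *
      ‖kernel ℂ (((List.ofFn fun i : Fin k => grassmannLaplacian ℂ (crossCov ℂ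
        ((sectorSubMatrix L M β Ft).transpose * normalCovariance L M (sym (if (i : ℕ) = 0 then s₀ else s₁)) * sectorSubMatrix L M β Ft))).reverse).prod
        (dblCopy ℂ 0 (sectorPreimage β F Ga) * dblCopy ℂ 1 (sectorPreimage β F Gb))) m (fun i => (Z i, s i))‖ ≤
      ((m₀ + (m₁ + 1) + (e' + 1))! : ℝ) / (m ! * (1 - x) ^ (m₀ + (m₁ + 1) + (e' + 1) + 1)) * (α * (δ * ((4 * ρ₀ : ℕ) : ℝ)) ^ e' * A) := by
  refine tail_core _ (fun k => norm_nonneg _) (by positivity : (0 : ℝ) ≤ α * (δ * ((4 * ρ₀ : ℕ) : ℝ)) ^ e')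
    (fun k => imagTimeWeight β M * Na k) (fun k => imagTimeWeight β M * Nb k) hx0 hx1 hA (fun k hk => ?_) henv
  have he : e' + 1 ≤ k := (mem_Icc.1 hk).1
  have h := norm_kernel_crossContract_value_sectorPreimage_le_gramF_of_b (ι := ι) he hβ F Ft hρ₀ sym
    (fun i : Fin k => if (i : ℕ) = 0 then s₀ else s₁)
    κ hκF hκG Ga Gb s hm₀ hm₁ Z hα (by rw [ite_castLE_zero he]; exact hrow) (by rw [ite_castLE_zero he]; exact hcol) (fun _ : Fin e' => δ)
    (fun _ => hδ) (fun i X Y => by rw [ite_castLE_succ he]; exact hent X Y) (hNa0 k) (hNa k hk) (hNb k hk)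
  rw [prod_const, Finset.card_univ, Fintype.card_fin] at h
  refine h.trans (le_of_eq ?_)
  ring

/-- **The assembled line-number tail, VALUE form, weight `((k−1)!)⁻¹`** (continuous source: `Δ_×(Ċ)∘(l!)⁻¹Δ_×(D)^l`, `k = l + 1`; hypotheses as in
`…_le_gramTail`): `≤ ((m₀+1+m₁+(e'+1)+1)!/(m!(1−x)^{m₀+1+m₁+(e'+1)+2}))·(α·(δ·4ρ₀)^{e'}·A)`. [cite: BenfattoGiulianiMastropietro2006, §2.8 (2.80)] -/
theorem sum_norm_kernel_crossContract_value_sectorPreimage_le_gramTail_mul {e' m m₀ m₁ Nmax : ℕ} {β : ℝ} (hβ : 0 ≤ β)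
    (F Ft : Fin N → FreqMomentum L M → ℂ)
    {ρ₀ : ℕ} (hρ₀ : ∀ ω : Fin N, ((univ : Finset (Fin N)).filter fun ω' => ∃ q, Ft ω q * Ft ω' q ≠ 0).card ≤ ρ₀)
    (sym : ι → FreqMomentum L M × Fin 2 → ℂ) (s₀ s₁ : ι) (κ : ι → ℝ)
    (hκF : ∀ (t : ι) (Y : SpaceTimeIdx L M × SectorLeg N), Y.2.2 = 0 → ‖sectorGramF L M β Ft (sym t) Y‖ ≤ κ t)
    (hκG : ∀ (t : ι) (Y : SpaceTimeIdx L M × SectorLeg N), Y.2.2 = 1 → ‖sectorGramG L M β Ft (sym t) Y‖ ≤ κ t)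
    (Ga Gb : HubbardGrassmann L M) (s : Fin m → Fin 2)
    (hm₀ : (univ.filter fun i => s i = 0).card = m₀ + 1) (hm₁ : (univ.filter fun i => s i = 1).card = m₁)
    (Z : Fin m → SpaceTimeIdx L M × SectorLeg N) {α : ℝ} (hα : 0 ≤ α)
    (hrow : ∀ X, ∑ Y, ‖((sectorSubMatrix L M β Ft).transpose * normalCovariance L M (sym s₀) * sectorSubMatrix L M β Ft) X Y‖ ≤ α)
    (hcol : ∀ Y, ∑ X, ‖((sectorSubMatrix L M β Ft).transpose * normalCovariance L M (sym s₀) * sectorSubMatrix L M β Ft) X Y‖ ≤ α)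
    {δ : ℝ} (hδ : 0 ≤ δ) (hent : ∀ X Y, ‖((sectorSubMatrix L M β Ft).transpose * normalCovariance L M (sym s₁) * sectorSubMatrix L M β Ft) X Y‖ ≤ δ)
    (Na Nb : ℕ → ℝ) (hNb0 : ∀ k, 0 ≤ Nb k)
    (hNa : ∀ k ∈ Icc (e' + 1) Nmax, ∀ σ₀ : Fin (m₀ + 1) → SectorLeg N, hubbardSectorKernelNorm L M β F (prescribedTuples univ
      (Fin.append (fun _ : Fin k => (none : Option (SectorLeg N))) (fun j => some (σ₀ j)))) Ga ≤ Na k)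
    (hNb : ∀ k ∈ Icc (e' + 1) Nmax, ∀ (ω₀ : SectorLeg N) (τ' : Fin e' → SectorLeg N) (ω₁ : Fin m₁ → SectorLeg N),
      hubbardSectorKernelNorm L M β F (prescribedTuples univ
        (Fin.append (fun i : Fin k => if h : (i : ℕ) < e' + 1 then some ((Fin.cons ω₀ τ' : Fin (e' + 1) → SectorLeg N) ⟨i, h⟩) else none)
          (fun j => some (ω₁ j)))) Gb ≤ Nb k)
    {x A : ℝ} (hx0 : 0 ≤ x) (hx1 : x < 1) (hA : 0 ≤ A)
    (henv : ∀ k ∈ Icc (e' + 1) Nmax,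
      (∑ t, κ t ^ 2) ^ (k - (e' + 1)) * ((imagTimeWeight β M * Na k) * (imagTimeWeight β M * Nb k)) ≤ x ^ (k - (e' + 1)) * A) :
    ∑ k ∈ Icc (e' + 1) Nmax, ((k - 1)! : ℝ)⁻¹ *
      ‖kernel ℂ (((List.ofFn fun i : Fin k => grassmannLaplacian ℂ (crossCov ℂ
        ((sectorSubMatrix L M β Ft).transpose * normalCovariance L M (sym (if (i : ℕ) = 0 then s₀ else s₁)) * sectorSubMatrix L M β Ft))).reverse).prod
        (dblCopy ℂ 0 (sectorPreimage β F Ga) * dblCopy ℂ 1 (sectorPreimage β F Gb))) m (fun i => (Z i, s i))‖ ≤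
      (((m₀ + 1) + m₁ + (e' + 1) + 1)! : ℝ) / (m ! * (1 - x) ^ ((m₀ + 1) + m₁ + (e' + 1) + 2)) * (α * (δ * ((4 * ρ₀ : ℕ) : ℝ)) ^ e' * A) := by
  refine tail_core_mul (Nat.succ_le_succ (Nat.zero_le e')) _ (fun k => norm_nonneg _)
    (by positivity : (0 : ℝ) ≤ α * (δ * ((4 * ρ₀ : ℕ) : ℝ)) ^ e')
    (fun k => imagTimeWeight β M * Na k) (fun k => imagTimeWeight β M * Nb k) hx0 hx1 hA (fun k hk => ?_) henv
  have he : e' + 1 ≤ k := (mem_Icc.1 hk).1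
  have h := norm_kernel_crossContract_value_sectorPreimage_le_gramF (ι := ι) he hβ F Ft hρ₀ sym (fun i : Fin k => if (i : ℕ) = 0 then s₀ else s₁)
    κ hκF hκG Ga Gb s hm₀ hm₁ Z hα (by rw [ite_castLE_zero he]; exact hrow) (by rw [ite_castLE_zero he]; exact hcol) (fun _ : Fin e' => δ)
    (fun _ => hδ) (fun i X Y => by rw [ite_castLE_succ he]; exact hent X Y) (hNb0 k) (hNa k hk) (hNb k hk)
  rw [prod_const, Finset.card_univ, Fintype.card_fin] at h
  refine h.trans (le_of_eq ?_)
  ring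

/-- **The assembled line-number tail, VALUE form, weight `((k−1)!)⁻¹`, roles exchanged.** [cite: BenfattoGiulianiMastropietro2006, §2.8 (2.80)] -/
theorem sum_norm_kernel_crossContract_value_sectorPreimage_le_gramTail_mul_of_b {e' m m₀ m₁ Nmax : ℕ} {β : ℝ} (hβ : 0 ≤ β)
    (F Ft : Fin N → FreqMomentum L M → ℂ)
    {ρ₀ : ℕ} (hρ₀ : ∀ ω : Fin N, ((univ : Finset (Fin N)).filter fun ω' => ∃ q, Ft ω q * Ft ω' q ≠ 0).card ≤ ρ₀)
    (sym : ι → FreqMomentum L M × Fin 2 → ℂ) (s₀ s₁ : ι) (κ : ι → ℝ)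
    (hκF : ∀ (t : ι) (Y : SpaceTimeIdx L M × SectorLeg N), Y.2.2 = 0 → ‖sectorGramF L M β Ft (sym t) Y‖ ≤ κ t)
    (hκG : ∀ (t : ι) (Y : SpaceTimeIdx L M × SectorLeg N), Y.2.2 = 1 → ‖sectorGramG L M β Ft (sym t) Y‖ ≤ κ t)
    (Ga Gb : HubbardGrassmann L M) (s : Fin m → Fin 2)
    (hm₀ : (univ.filter fun i => s i = 0).card = m₀) (hm₁ : (univ.filter fun i => s i = 1).card = m₁ + 1)
    (Z : Fin m → SpaceTimeIdx L M × SectorLeg N) {α : ℝ} (hα : 0 ≤ α)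
    (hrow : ∀ X, ∑ Y, ‖((sectorSubMatrix L M β Ft).transpose * normalCovariance L M (sym s₀) * sectorSubMatrix L M β Ft) X Y‖ ≤ α)
    (hcol : ∀ Y, ∑ X, ‖((sectorSubMatrix L M β Ft).transpose * normalCovariance L M (sym s₀) * sectorSubMatrix L M β Ft) X Y‖ ≤ α)
    {δ : ℝ} (hδ : 0 ≤ δ) (hent : ∀ X Y, ‖((sectorSubMatrix L M β Ft).transpose * normalCovariance L M (sym s₁) * sectorSubMatrix L M β Ft) X Y‖ ≤ δ)
    (Na Nb : ℕ → ℝ) (hNa0 : ∀ k, 0 ≤ Na k)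
    (hNa : ∀ k ∈ Icc (e' + 1) Nmax, ∀ (ω₀ : SectorLeg N) (σ' : Fin e' → SectorLeg N) (ω₁ : Fin m₀ → SectorLeg N),
      hubbardSectorKernelNorm L M β F (prescribedTuples univ
        (Fin.append (fun i : Fin k => if h : (i : ℕ) < e' + 1 then some ((Fin.cons ω₀ σ' : Fin (e' + 1) → SectorLeg N) ⟨i, h⟩) else none)
          (fun j => some (ω₁ j)))) Ga ≤ Na k)
    (hNb : ∀ k ∈ Icc (e' + 1) Nmax, ∀ σ₁ : Fin (m₁ + 1) → SectorLeg N, hubbardSectorKernelNorm L M β F (prescribedTuples univ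
      (Fin.append (fun _ : Fin k => (none : Option (SectorLeg N))) (fun j => some (σ₁ j)))) Gb ≤ Nb k)
    {x A : ℝ} (hx0 : 0 ≤ x) (hx1 : x < 1) (hA : 0 ≤ A)
    (henv : ∀ k ∈ Icc (e' + 1) Nmax,
      (∑ t, κ t ^ 2) ^ (k - (e' + 1)) * ((imagTimeWeight β M * Na k) * (imagTimeWeight β M * Nb k)) ≤ x ^ (k - (e' + 1)) * A) :
    ∑ k ∈ Icc (e' + 1) Nmax, ((k - 1)! : ℝ)⁻¹ *
      ‖kernel ℂ (((List.ofFn fun i : Fin k => grassmannLaplacian ℂ (crossCov ℂ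
        ((sectorSubMatrix L M β Ft).transpose * normalCovariance L M (sym (if (i : ℕ) = 0 then s₀ else s₁)) * sectorSubMatrix L M β Ft))).reverse).prod
        (dblCopy ℂ 0 (sectorPreimage β F Ga) * dblCopy ℂ 1 (sectorPreimage β F Gb))) m (fun i => (Z i, s i))‖ ≤
      ((m₀ + (m₁ + 1) + (e' + 1) + 1)! : ℝ) / (m ! * (1 - x) ^ (m₀ + (m₁ + 1) + (e' + 1) + 2)) * (α * (δ * ((4 * ρ₀ : ℕ) : ℝ)) ^ e' * A) := by
  refine tail_core_mul (Nat.succ_le_succ (Nat.zero_le e')) _ (fun k => norm_nonneg _)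
    (by positivity : (0 : ℝ) ≤ α * (δ * ((4 * ρ₀ : ℕ) : ℝ)) ^ e')
    (fun k => imagTimeWeight β M * Na k) (fun k => imagTimeWeight β M * Nb k) hx0 hx1 hA (fun k hk => ?_) henv
  have he : e' + 1 ≤ k := (mem_Icc.1 hk).1
  have h := norm_kernel_crossContract_value_sectorPreimage_le_gramF_of_b (ι := ι) he hβ F Ft hρ₀ sym
    (fun i : Fin k => if (i : ℕ) = 0 then s₀ else s₁)
    κ hκF hκG Ga Gb s hm₀ hm₁ Z hα (by rw [ite_castLE_zero he]; exact hrow) (by rw [ite_castLE_zero he]; exact hcol) (fun _ : Fin e' => δ)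
    (fun _ => hδ) (fun i X Y => by rw [ite_castLE_succ he]; exact hent X Y) (hNa0 k) (hNa k hk) (hNb k hk)
  rw [prod_const, Finset.card_univ, Fintype.card_fin] at h
  refine h.trans (le_of_eq ?_)
  ring

end Engine

/-! ## §4 Glue for the consumer (rev 2, p5 g6): the exponential series' `ℚ`-weights, their norms, and the `i ↦ k = i + 1` re-indexing

`gaussConv_eq_sum_range` writes `e^{Δ_×(D)} = Σ_{i<N+2} (i! : ℚ)⁻¹ • Δ_×(D)^i` with RATIONAL scalars; `…TailPushforward` takes complex weights `c i` and
charges `‖c i‖`; the tail sums above are indexed by the line number `k = i + 1` over `Icc (e'+1) Nmax`.  Three one-liners close the gap. -/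

section Glue

variable {Γ : Type*} [Fintype Γ] [DecidableEq Γ] [LinearOrder Γ]

omit [Fintype Γ] [DecidableEq Γ] [LinearOrder Γ] in
/-- A rational scalar acts on the complex Grassmann algebra as its complex cast. [folklore] -/
theorem rat_smul_eq_complex_smul (q : ℚ) (x : GrassmannAlgebra ℂ Γ) : q • x = ((q : ℂ)) • x := by
  rw [← IsScalarTower.algebraMap_smul ℂ q x]
  rfl

/-- `‖(i! : ℂ)⁻¹‖ = (i!)⁻¹`. [folklore] -/
theorem norm_inv_natCast_factorial (i : ℕ) : ‖((i ! : ℂ))⁻¹‖ = ((i ! : ℝ))⁻¹ := by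
  rw [norm_inv, Complex.norm_natCast]

/-- Re-indexing a sum over `Icc a b` by `k = i + 1`. [folklore] -/
theorem sum_Icc_succ_shift {A : Type*} [AddCommMonoid A] (f : ℕ → A) (a b : ℕ) :
    ∑ i ∈ Icc a b, f (i + 1) = ∑ k ∈ Icc (a + 1) (b + 1), f k := by
  rw [← Finset.map_add_right_Icc, Finset.sum_map]
  rfl

end Glue

end Summit.HubbardSuperconductivity.HubbardSuperconductivity.Theorems.KLRegimeWick

end
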